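import Summits.ResolutionOfSingularities.ResolutionOfSingularities.Theorems.FrobeniusLadderFInjectiveMacaulayficationFullNoKangaroo
import Mathlib.Algebra.CharP.Lemmas
import HarnessLib

/-!
# (T-register #9♯, kernel brick) THE `p = 5` EDGE LEMMA: `f = ℓ^p + h` with `ℓ ∈ 𝔪`, `h ∈ 𝔪^{p+1}` (mixed terms allowed) is NEVER a Fedder survivor in `n ≤ p` variables —
# `f^{p−1} ∈ 𝔪^{[p]}`
# (crux `FInjectiveMacaulayfication` stmt-ResolutionOfSingularities-15315, chain w45a; res-L1-w45a-plan-1 RULING R24.10 (4) «p = 5 EDGE LEMMA ADOPTED (extends ✓p710092 to mixed terms and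
# n = p) … GO stub-1 g16: `not_survivor_of_pth_power_add (hn : n ≤ p)` … polynomial-ring form first»; res-L1-w45a-tri-2 g22ʼs ten-line argument `T9-CAP-REGIME-BREAKTEST-tri2.md`; consumer
# = `Lines/T-register.md` row #9♯; seat res-L1-w45a-stub-1 g16)

[OURS · L1 W4.5a] Support file (`--supports stmt-ResolutionOfSingularities-15315 --as helper`); theorems only; UNCONDITIONAL; pure exponent combinatorics plus Frobenius in a polynomial ring
over any commutative ring of prime characteristic `p`; no named fact; NOT a statement of any manuscript; nothing of the crux is proved (one Fedder non-membership, evidence for row #9♯ only).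
AI-written (AI review is weaker than expert review).

THE LEMMA. `S = A[X₁, …, X_n]`, `char A = p` prime, `𝔪 = (X₁, …, X_n)`, `𝔪^{[p]} = (X₁^p, …, X_n^p)`. If `n ≤ p`, `ℓ ∈ 𝔪` and every monomial of `h` has degree `≥ p + 1`, then
`(ℓ^p + h)^{p−1} ∈ 𝔪^{[p]}`. PROOF: `ℓ^p = Frob(ℓ) ∈ Frob(𝔪)·S = 𝔪^{[p]}` (`pow_char_mem_frobeniusPower`), so `(ℓ^p + h)^{p−1} ≡ h^{p−1}` modulo `𝔪^{[p]}` (`add_pow_mem_iff_of_mem`); every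
monomial of `h^{p−1}` has degree `≥ (p−1)(p+1)`, whereas a monomial outside `𝔪^{[p]}` (all exponents `≤ p − 1`) has degree `≤ n(p−1) ≤ p(p−1) < (p−1)(p+1)` (`mem_frobeniusPower_of_order_ge`).
By Fedder (✓ `fedder_criterion_origin`) the hypersurface `{ℓ^p + h = 0}` is then NOT F-pure at the origin: on a FULL floor in `n ≤ p` letters a point whose initial form is a `p`-th power of a
regular parameter — with the rest of the equation in `𝔪^{p+1}` — does not occur. RELATION TO ✓ `FullNoKangaroo.not_survivor_of_order_ge` (✓p710092): there `h` is free of the `p`-th-power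
variable and order `≥ p` suffices (the count runs over `n − 1 < p` variables); here `h` may involve every variable («mixed terms»), `ℓ` is any element of `𝔪` (not only a variable), the price
being order `≥ p + 1` and `n ≤ p` (sharp: `n = p + 1`, `h = (X₁⋯X_{p+1})·g` can survive). The local-ring form (`R` regular local, `𝔪^{p²−1} ⊆ 𝔪^{[p]}`) is not typed here.
* `pow_char_mem_frobeniusPower` (`ℓ ∈ 𝔪 ⇒ ℓ^p ∈ 𝔪^{[p]}`), `add_pow_mem_iff_of_mem` (`T ∈ J ⇒ ((T + h)^m ∈ J ↔ h^m ∈ J)`), `degree_le_of_forall_lt` (all exponents `< p` ⇒ degree `≤ n(p−1)`),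
  `mem_frobeniusPower_of_order_ge` (`ord φ ≥ N`, `n(p−1) < N·m`… see statement ⇒ `φ^m ∈ 𝔪^{[p]}`), ★★ `not_survivor_of_pth_power_add`, ★ `not_survivor_of_X_pow_add` (`ℓ = X i`).
[cite: Fedder1983, Thm. 1.12 (context: the survivor criterion)] [folklore computation]
-/

-- single-problem summit: the doubled namespace component is forced
set_option linter.dupNamespace false

noncomputable section

open MvPolynomial Finsupp

namespace Summit.ResolutionOfSingularities.ResolutionOfSingularities.Theorems.FInjectiveMacaulayfication.FullPthPowerEdge

open Summit.ResolutionOfSingularities.ResolutionOfSingularities.Theorems.FInjectiveMacaulayfication FullNoKangaroo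

variable {A : Type} [CommRing A] {n : ℕ}

/-- **`ℓ ∈ 𝔪 = (X₁, …, X_n) ⇒ ℓ^p ∈ 𝔪^{[p]} = (X₁^p, …, X_n^p)`** in characteristic `p` (Frobenius is a ring homomorphism carrying `𝔪` into `𝔪^{[p]}`). [folklore] -/
theorem pow_char_mem_frobeniusPower (p : ℕ) [Fact p.Prime] [CharP A p] (ℓ : MvPolynomial (Fin n) A) (hℓ : ℓ ∈ Ideal.span (Set.range (X : Fin n → MvPolynomial (Fin n) A))) :
    ℓ ^ p ∈ Ideal.span (Set.range fun i : Fin n => (X i : MvPolynomial (Fin n) A) ^ p) := by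
  have hmap : (Ideal.span (Set.range (X : Fin n → MvPolynomial (Fin n) A))).map (frobenius (MvPolynomial (Fin n) A) p) =
      Ideal.span (Set.range fun i : Fin n => (X i : MvPolynomial (Fin n) A) ^ p) := by
    rw [Ideal.map_span, ← Set.range_comp]
    rfl
  rw [← frobenius_def, ← hmap]
  exact Ideal.mem_map_of_mem _ hℓ

/-- **`(T + h)^m ∈ J ↔ h^m ∈ J` when `T ∈ J`** (modulo `J`, `T + h ≡ h`). [folklore] -/
theorem add_pow_mem_iff_of_mem {B : Type} [CommRing B] (J : Ideal B) {T : B} (hT : T ∈ J) (h : B) (m : ℕ) : (T + h) ^ m ∈ J ↔ h ^ m ∈ J := by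
  rw [← Ideal.Quotient.eq_zero_iff_mem, ← Ideal.Quotient.eq_zero_iff_mem, map_pow, map_pow, map_add, Ideal.Quotient.eq_zero_iff_mem.mpr hT, zero_add]

/-- A monomial with every exponent `< p` has degree `≤ n·(p − 1)`. [plumbing] -/
theorem degree_le_of_forall_lt (p : ℕ) (d : Fin n →₀ ℕ) (hd : ∀ i, d i < p) : degree d ≤ n * (p - 1) := by
  rw [degree_eq_sum]
  have hs := Finset.sum_le_sum fun i (_ : i ∈ (Finset.univ : Finset (Fin n))) => Nat.le_sub_one_of_lt (hd i)
  simpa [Finset.sum_const, smul_eq_mul] using hs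

/-- **High order forces membership in `𝔪^{[p]}`**: if every monomial of `φ` has degree `≥ N` and `n·(p − 1) < m·N`, then `φ^m ∈ (X₁^p, …, X_n^p)` (a survivor of `φ^m` would have degree
`≤ n(p−1)` and `≥ m·N` at once). [folklore] -/
theorem mem_frobeniusPower_of_order_ge (p : ℕ) (φ : MvPolynomial (Fin n) A) (N m : ℕ) (hφ : ∀ d ∈ φ.support, N ≤ degree d) (hlt : n * (p - 1) < m * N) :
    φ ^ m ∈ Ideal.span (Set.range fun i : Fin n => (X i : MvPolynomial (Fin n) A) ^ p) := by
  by_contra hF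
  obtain ⟨d, hd, hdp⟩ := exists_support_lt_of_not_mem p _ hF
  have hlow : m * N ≤ degree d := le_degree_of_mem_support_pow φ N hφ m d hd
  have hhigh : degree d ≤ n * (p - 1) := degree_le_of_forall_lt p d hdp
  omega

/-- ★★ **THE EDGE LEMMA (`n ≤ p`).** In `A[X₁, …, X_n]` with `char A = p` prime and `n ≤ p`: if `ℓ ∈ (X₁, …, X_n)` and every monomial of `h` has degree `≥ p + 1` (mixed terms allowed),
then `(ℓ^p + h)^{p−1} ∈ (X₁^p, …, X_n^p)` — the hypersurface `ℓ^p + h = 0` is NOT a Fedder survivor (not F-pure at the origin). In five letters (`n = 5 ≤ p` for every `p ≥ 5`): on a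
FULL floor no point has a `p`-th-power initial form of degree `p` with remainder in `𝔪^{p+1}` — T-register row #9♯ʼs «wild top layer absent for every `p ≥ 5`», the `p = 5` edge
included. [OURS · R24.10 (4); cite: Fedder1983, Thm. 1.12 (context)] -/
theorem not_survivor_of_pth_power_add (p : ℕ) [hp : Fact p.Prime] [CharP A p] (hn : n ≤ p) (ℓ h : MvPolynomial (Fin n) A)
    (hℓ : ℓ ∈ Ideal.span (Set.range (X : Fin n → MvPolynomial (Fin n) A))) (hh : ∀ d ∈ h.support, p + 1 ≤ degree d)
    (f : MvPolynomial (Fin n) A) (hf : f = ℓ ^ p + h) :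
    f ^ (p - 1) ∈ Ideal.span (Set.range fun i : Fin n => (X i : MvPolynomial (Fin n) A) ^ p) := by
  have hp2 : 2 ≤ p := hp.out.two_le
  rw [hf, add_pow_mem_iff_of_mem _ (pow_char_mem_frobeniusPower p ℓ hℓ)]
  refine mem_frobeniusPower_of_order_ge p h (p + 1) (p - 1) hh ?_
  -- `n(p−1) ≤ p(p−1) < (p−1)(p+1)`
  have h1 : n * (p - 1) ≤ p * (p - 1) := Nat.mul_le_mul_right _ hn
  have h2 : p * (p - 1) < (p - 1) * (p + 1) := by
    have : (p - 1) * (p + 1) = p * (p - 1) + (p - 1) := by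
      rcases p with _ | p
      · omega
      · simp; ring
    rw [this]; omega
  exact lt_of_le_of_lt h1 h2

/-- ★ **The same with `ℓ = X i` a variable**: `(X_i^p + h)^{p−1} ∈ (X₁^p, …, X_n^p)` for `ord h ≥ p + 1`, `n ≤ p` — the mixed-term twin of ✓ `FullNoKangaroo.not_survivor_of_order_ge`.
[OURS · R24.10 (4)] -/
theorem not_survivor_of_X_pow_add (p : ℕ) [Fact p.Prime] [CharP A p] (hn : n ≤ p) (i : Fin n) (h : MvPolynomial (Fin n) A) (hh : ∀ d ∈ h.support, p + 1 ≤ degree d)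
    (f : MvPolynomial (Fin n) A) (hf : f = X i ^ p + h) :
    f ^ (p - 1) ∈ Ideal.span (Set.range fun i : Fin n => (X i : MvPolynomial (Fin n) A) ^ p) :=
  not_survivor_of_pth_power_add p hn (X i) h (Ideal.subset_span ⟨i, rfl⟩) hh f hf

end Summit.ResolutionOfSingularities.ResolutionOfSingularities.Theorems.FInjectiveMacaulayfication.FullPthPowerEdge

end
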